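import Mathlib.Algebra.Polynomial.Splits
import Mathlib.FieldTheory.IsAlgClosed.Basic
import Mathlib.Algebra.Order.BigOperators.GroupWithZero.Multiset
import Literature.NumberTheory.DiophantineGeometry.GenEllAnnulus
import HarnessLib

set_option linter.dupNamespace false -- `Summit.ABC.ABC.…`: summit = problem = `ABC` (cell layout)

/-!
# Route `route-ABC-IUTThetaPilot`, support item `GenEllTwo` (stmt-ABC-19679) — helper:
# effective properness of a rational function on `ℙ¹` away from its special fibres

For `β = p/q` on `ℙ¹` over a normed field `K` in which the relevant polynomials split, and `δ > 0`:
every `t ∈ K` that is `δ`-far from the fibre `B := β⁻¹{0,1,∞} ∖ {∞} = Z(p) ∪ Z(q) ∪ Z(p − q)` has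
`β(t)` EXPLICITLY far from the three cusps (`ρ ≤ ‖β t‖ ≤ ρ⁻¹`, `ρ ≤ ‖β t − 1‖`) when
`β(∞) ∉ {0,1,∞}` (`deg p = deg q`, `lead p ≠ lead q`); and for ANY `γ = p/q` and `a ∈ K`, `t` `δ`-far
from the fibre `γ⁻¹(a) = Z(p − a q)` has `γ(t)` explicitly far from `a` (`le_norm_eval_div_sub`,
covering maps with `γ(∞) = ∞` such as cusp-preserving Belyi maps).  Contrapositively: `β(t)` close
to a cusp (resp. `γ(t)` close to `a`) forces `t` close to the fibre — the properness of
`ℙ¹ → ℙ¹`, in a form needing NO local compactness of `K`, so valid verbatim over `ℂ` and over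
`Q̄_ℓ = PadicAlgCl ℓ`.  Engine (`leadingCoeff_mul_norm_eval_le`): for split `f, g` with
`deg f = deg g + k`, roots in the `M`-ball and `t` `δ`-far from the roots of `f`,
`‖lead f‖·δᵏ·‖g(t)‖ ≤ ‖lead g‖·(1 + 2M/δ)^{deg g}·‖f(t)‖`.

Use: [GenEll] Thm. 2.1, proof p. 12, the step "the compactness of the set of rational points … over
any finite extension of `ℚ_v`" for a noncritical Belyi map, here made effective for its `ℙ¹`
factor; the number-field wrapper `GenEllTwo.farFromCusps_of_far_from_aroots` produces the
predicate `GenEll.NFPoint.FarFromCusps S ρ` of `GenEllAnnulus.lean` for the point `(F, β(x))` from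
"every complex / `Q̄_ℓ` (`ℓ ∈ S`) conjugate of `x` is `δ`-far from `B`", `ρ` uniform in `(F, x)`.
(Cell abc-iut; HELPER LEMMAS `--supports stmt-ABC-19679`, not a closing theorem; work package W7
"properness" of abc-iut-S6's GENELLTWO-P1ROUTE.md, the `ℙ¹` half, and the fibre-localisation input
of W8 "a slot defeats `γ` only near `γ⁻¹(X_φ)`"; the curve half `D_e → ℙ¹` lives elsewhere.)  S. Mochizuki, *Arithmetic elliptic curves in general position*, Math. J. Okayama
Univ. 52 (2010), Thm. 2.1 [cite: MochizukiGenEll2010] — classical and undisputed; nothing here bears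
on [IUTchIII].  No definitions, no named facts.
-/

noncomputable section

open Polynomial

namespace Summit.ABC.ABC.Theorems

namespace GenEllTwo.P1Properness

open Literature.NumberTheory.DiophantineGeometry

variable {K : Type*} [NormedField K]

/-! ### Norms of values of split polynomials -/

/-- For a split polynomial `f = c·∏ᵢ (X − aᵢ)` and any `t`, `‖f(t)‖ = ‖c‖·∏ᵢ ‖t − aᵢ‖` (the product
over the multiset of roots). [folklore] -/
theorem norm_eval_eq_prod_roots {f : K[X]} (hf : f.Splits) (t : K) :
    ‖f.eval t‖ = ‖f.leadingCoeff‖ * (f.roots.map fun a => ‖t - a‖).prod := by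
  rw [hf.eval_eq_prod_roots, norm_mul]
  exact congrArg _ ((map_multiset_prod (normHom : K →*₀ ℝ) _).trans (by rw [Multiset.map_map]; rfl))

/-- Lower bound: if every root `a` of the split polynomial `f` satisfies `u ≤ ‖t − a‖` (`0 ≤ u`),
then `‖lead f‖ · u ^ deg f ≤ ‖f(t)‖`. [folklore] -/
theorem mul_pow_le_norm_eval {f : K[X]} (hf : f.Splits) {t : K} {u : ℝ} (hu : 0 ≤ u)
    (h : ∀ a ∈ f.roots, u ≤ ‖t - a‖) :
    ‖f.leadingCoeff‖ * u ^ f.natDegree ≤ ‖f.eval t‖ := by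
  rw [norm_eval_eq_prod_roots hf, hf.natDegree_eq_card_roots]
  refine mul_le_mul_of_nonneg_left ?_ (norm_nonneg _)
  have h1 : (f.roots.map fun _ => u).prod ≤ (f.roots.map fun a => ‖t - a‖).prod :=
    Multiset.prod_map_le_prod_map₀ _ _ (fun _ _ => hu) h
  rwa [Multiset.map_const', Multiset.prod_replicate] at h1

/-- Upper bound: if every root `a` of the split polynomial `f` satisfies `‖t − a‖ ≤ v`, then
`‖f(t)‖ ≤ ‖lead f‖ · v ^ deg f`. [folklore] -/
theorem norm_eval_le_mul_pow {f : K[X]} (hf : f.Splits) {t : K} {v : ℝ}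
    (h : ∀ a ∈ f.roots, ‖t - a‖ ≤ v) :
    ‖f.eval t‖ ≤ ‖f.leadingCoeff‖ * v ^ f.natDegree := by
  rw [norm_eval_eq_prod_roots hf, hf.natDegree_eq_card_roots]
  refine mul_le_mul_of_nonneg_left ?_ (norm_nonneg _)
  have h1 : (f.roots.map fun a => ‖t - a‖).prod ≤ (f.roots.map fun _ => v).prod :=
    Multiset.prod_map_le_prod_map₀ _ _ (fun _ _ => norm_nonneg _) h
  rwa [Multiset.map_const', Multiset.prod_replicate] at h1

/-- A nonzero polynomial does not vanish at positive distance from all its roots. [folklore] -/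
theorem eval_ne_zero_of_far {f : K[X]} (hf0 : f ≠ 0) {t : K} {δ : ℝ} (hδ : 0 < δ)
    (h : ∀ a ∈ f.roots, δ ≤ ‖t - a‖) : f.eval t ≠ 0 := by
  intro ht
  have := h t ((mem_roots hf0).mpr ht)
  rw [sub_self, norm_zero] at this
  exact absurd this (not_le.mpr hδ)

/-! ### The comparison of two split polynomials of the same degree -/

/-- The real inequality behind the comparison: `s + M ≤ (1 + 2M/δ) · max δ (s − M)`. [folklore] -/
theorem add_le_mul_max (s : ℝ) {M δ : ℝ} (hδ : 0 < δ) (hM : 0 ≤ M) :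
    s + M ≤ (1 + 2 * M / δ) * max δ (s - M) := by
  rcases le_or_gt δ (s - M) with h | h
  · rw [max_eq_right h]
    have h1 : 1 ≤ (s - M) / δ := by rwa [le_div_iff₀ hδ, one_mul]
    have h2 : 0 ≤ s - M := hδ.le.trans h
    calc s + M = (s - M) + 2 * M * 1 := by ring
      _ ≤ (s - M) + 2 * M * ((s - M) / δ) := by gcongr
      _ = (1 + 2 * M / δ) * (s - M) := by ring
  · rw [max_eq_left h.le]
    calc s + M = (s - M) + 2 * M := by ring
      _ ≤ δ + 2 * M := by linarith
      _ = (1 + 2 * M / δ) * δ := by rw [add_mul, one_mul, div_mul_cancel₀ _ hδ.ne']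

/-- **Comparison of two split polynomials.**  Let `f, g ∈ K[X]` split, `deg f = deg g + k`, with
all roots of both in the closed ball of radius `M ≥ 0`, and let `t` be `δ`-far (`δ > 0`) from every
root of `f`.  Then `‖lead f‖ · δᵏ · ‖g(t)‖ ≤ ‖lead g‖ · (1 + 2M/δ)^{deg g} · ‖f(t)‖`, for ALL such `t`
(bounded or not).  Proof: with `u := max δ (‖t‖ − M)`, every root `a` of `f` has `‖t − a‖ ≥ u` and
every root `b` of `g` has `‖t − b‖ ≤ ‖t‖ + M ≤ (1 + 2M/δ)·u` (`add_le_mul_max`), and `δᵏ ≤ uᵏ`.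
[folklore] -/
theorem leadingCoeff_mul_norm_eval_le {f g : K[X]} (hf : f.Splits) (hg : g.Splits) {k : ℕ}
    (hdeg : f.natDegree = g.natDegree + k) {M δ : ℝ} (hδ : 0 < δ) (hM : 0 ≤ M)
    (hfM : ∀ a ∈ f.roots, ‖a‖ ≤ M) (hgM : ∀ b ∈ g.roots, ‖b‖ ≤ M) {t : K}
    (ht : ∀ a ∈ f.roots, δ ≤ ‖t - a‖) :
    ‖f.leadingCoeff‖ * δ ^ k * ‖g.eval t‖ ≤
      ‖g.leadingCoeff‖ * (1 + 2 * M / δ) ^ g.natDegree * ‖f.eval t‖ := by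
  set u : ℝ := max δ (‖t‖ - M) with hu_def
  have hδu : δ ≤ u := le_max_left _ _
  have hu0 : 0 ≤ u := hδ.le.trans hδu
  have hlow : ‖f.leadingCoeff‖ * u ^ f.natDegree ≤ ‖f.eval t‖ := by
    refine mul_pow_le_norm_eval hf hu0 fun a ha => max_le (ht a ha) ?_
    calc ‖t‖ - M ≤ ‖t‖ - ‖a‖ := by linarith [hfM a ha]
      _ ≤ ‖t - a‖ := norm_sub_norm_le t a
  have hup : ‖g.eval t‖ ≤ ‖g.leadingCoeff‖ * ((1 + 2 * M / δ) * u) ^ g.natDegree := by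
    refine norm_eval_le_mul_pow hg fun b hb => ?_
    calc ‖t - b‖ ≤ ‖t‖ + ‖b‖ := norm_sub_le t b
      _ ≤ ‖t‖ + M := by linarith [hgM b hb]
      _ ≤ (1 + 2 * M / δ) * u := add_le_mul_max ‖t‖ hδ hM
  rw [mul_pow] at hup
  rw [hdeg, pow_add] at hlow
  have hδk : δ ^ k ≤ u ^ k := pow_le_pow_left₀ hδ.le hδu k
  calc ‖f.leadingCoeff‖ * δ ^ k * ‖g.eval t‖
      ≤ ‖f.leadingCoeff‖ * u ^ k *
          (‖g.leadingCoeff‖ * ((1 + 2 * M / δ) ^ g.natDegree * u ^ g.natDegree)) := by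
        gcongr
    _ = ‖g.leadingCoeff‖ * (1 + 2 * M / δ) ^ g.natDegree *
          (‖f.leadingCoeff‖ * (u ^ g.natDegree * u ^ k)) := by ring
    _ ≤ ‖g.leadingCoeff‖ * (1 + 2 * M / δ) ^ g.natDegree * ‖f.eval t‖ :=
        mul_le_mul_of_nonneg_left hlow (by positivity)

/-- Ratio form of `leadingCoeff_mul_norm_eval_le`: under the same hypotheses and `g ≠ 0`,
`‖lead f‖ · δᵏ / (‖lead g‖ · (1 + 2M/δ)^{deg g}) ≤ ‖f(t) / g(t)‖` whenever `g(t) ≠ 0`.  With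
`f = p − a·q`, `g = q` this reads: `t` `δ`-far from the fibre `γ⁻¹(a)` of `γ = p/q` ⇒ `γ(t)`
explicitly far from `a` (`le_norm_eval_div_sub`). [folklore] -/
theorem div_le_norm_eval_div {f g : K[X]} (hf : f.Splits) (hg : g.Splits) (hg0 : g ≠ 0) {k : ℕ}
    (hdeg : f.natDegree = g.natDegree + k) {M δ : ℝ} (hδ : 0 < δ) (hM : 0 ≤ M)
    (hfM : ∀ a ∈ f.roots, ‖a‖ ≤ M) (hgM : ∀ b ∈ g.roots, ‖b‖ ≤ M) {t : K}
    (ht : ∀ a ∈ f.roots, δ ≤ ‖t - a‖) (hgt : g.eval t ≠ 0) :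
    ‖f.leadingCoeff‖ * δ ^ k / (‖g.leadingCoeff‖ * (1 + 2 * M / δ) ^ g.natDegree) ≤
      ‖f.eval t / g.eval t‖ := by
  have hlc : 0 < ‖g.leadingCoeff‖ := norm_pos_iff.mpr (leadingCoeff_ne_zero.mpr hg0)
  have hden : 0 < ‖g.leadingCoeff‖ * (1 + 2 * M / δ) ^ g.natDegree := by positivity
  rw [norm_div, div_le_div_iff₀ hden (norm_pos_iff.mpr hgt)]
  calc ‖f.leadingCoeff‖ * δ ^ k * ‖g.eval t‖
      ≤ ‖g.leadingCoeff‖ * (1 + 2 * M / δ) ^ g.natDegree * ‖f.eval t‖ :=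
        leadingCoeff_mul_norm_eval_le hf hg hdeg hδ hM hfM hgM ht
    _ = ‖f.eval t‖ * (‖g.leadingCoeff‖ * (1 + 2 * M / δ) ^ g.natDegree) := by ring

/-- **Fibre form** (any rational map `γ = p/q`, e.g. one with `γ(∞) = ∞` such as a polynomial or a
cusp-preserving Belyi map): if `p − a·q` and `q` split, `deg (p − a·q) = deg q + k`, all roots lie
in the `M`-ball and `t` is `δ`-far from every root of `p − a·q` (= the fibre `γ⁻¹(a)`), then
`‖lead (p − a·q)‖ · δᵏ / (‖lead q‖ · (1 + 2M/δ)^{deg q}) ≤ ‖γ(t) − a‖`.  Contrapositively: `γ(t)`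
close to `a` forces `t` close to the fibre over `a`. [folklore] -/
theorem le_norm_eval_div_sub {p q : K[X]} (a : K) (hps : (p - C a * q).Splits) (hqs : q.Splits)
    (hq0 : q ≠ 0) {k : ℕ} (hdeg : (p - C a * q).natDegree = q.natDegree + k) {M δ : ℝ}
    (hδ : 0 < δ) (hM : 0 ≤ M) (hpM : ∀ w ∈ (p - C a * q).roots, ‖w‖ ≤ M)
    (hqM : ∀ b ∈ q.roots, ‖b‖ ≤ M) {t : K} (ht : ∀ w ∈ (p - C a * q).roots, δ ≤ ‖t - w‖)
    (hqt : q.eval t ≠ 0) :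
    ‖(p - C a * q).leadingCoeff‖ * δ ^ k / (‖q.leadingCoeff‖ * (1 + 2 * M / δ) ^ q.natDegree) ≤
      ‖p.eval t / q.eval t - a‖ := by
  have h : p.eval t / q.eval t - a = (p - C a * q).eval t / q.eval t := by
    rw [eval_sub, eval_mul, eval_C, sub_div, mul_div_assoc, div_self hqt, mul_one]
  rw [h]
  exact div_le_norm_eval_div hps hqs hq0 hdeg hδ hM hpM hqM ht hqt

/-! ### The packaged properness statement for `β = p/q` with `β(∞) ∉ {0, 1, ∞}` -/

/-- Bookkeeping: if `deg p = deg q` and `lead p ≠ lead q` then `deg (p − q) = deg p`. [folklore] -/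
theorem natDegree_sub_eq_of_leadingCoeff_ne {p q : K[X]} (hdeg : p.natDegree = q.natDegree)
    (hlead : p.leadingCoeff ≠ q.leadingCoeff) : (p - q).natDegree = p.natDegree := by
  apply le_antisymm
  · calc (p - q).natDegree ≤ max p.natDegree q.natDegree := natDegree_sub_le p q
      _ = p.natDegree := by rw [← hdeg, max_self]
  · -- the coefficient of `p - q` in degree `deg p` is `lead p - lead q ≠ 0`
    refine le_natDegree_of_ne_zero ?_
    rw [coeff_sub, ← leadingCoeff, hdeg, ← leadingCoeff, sub_ne_zero]
    exact hlead

/-- **Effective properness of `β = p/q : ℙ¹ → ℙ¹` near the cusps** (split form, explicit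
constant).  Let `p, q, p − q` split over the normed field `K`, `p ≠ 0`, `q ≠ 0`, `deg p = deg q =: n`,
`lead p ≠ lead q` (so `β(∞) = lead p / lead q ∉ {0, 1, ∞}`); let `M ≥ 0` bound the norms of all
roots of `p`, `q`, `p − q`, and let `t` be `δ`-far (`δ > 0`) from all these roots.  Then with
`c := (1 + 2M/δ)ⁿ`:  `‖lead p‖/(‖lead q‖·c) ≤ ‖β t‖`, `‖β t‖ ≤ ‖lead p‖·c/‖lead q‖`, and
`‖lead p − lead q‖/(‖lead q‖·c) ≤ ‖β t − 1‖`. [cite: MochizukiGenEll2010, Thm 2.1 (proof) p.12] -/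
theorem bounds_of_far_from_fibres {p q : K[X]} (hp : p ≠ 0) (hq : q ≠ 0)
    (hdeg : p.natDegree = q.natDegree) (hlead : p.leadingCoeff ≠ q.leadingCoeff)
    (hps : p.Splits) (hqs : q.Splits) (hpqs : (p - q).Splits) {M δ : ℝ} (hδ : 0 < δ) (hM : 0 ≤ M)
    (hpM : ∀ a ∈ p.roots, ‖a‖ ≤ M) (hqM : ∀ b ∈ q.roots, ‖b‖ ≤ M)
    (hpqM : ∀ b ∈ (p - q).roots, ‖b‖ ≤ M) {t : K} (htp : ∀ a ∈ p.roots, δ ≤ ‖t - a‖)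
    (htq : ∀ b ∈ q.roots, δ ≤ ‖t - b‖) (htpq : ∀ b ∈ (p - q).roots, δ ≤ ‖t - b‖) :
    ‖p.leadingCoeff‖ / (‖q.leadingCoeff‖ * (1 + 2 * M / δ) ^ p.natDegree) ≤
        ‖p.eval t / q.eval t‖ ∧
      ‖p.eval t / q.eval t‖ ≤
        ‖p.leadingCoeff‖ * (1 + 2 * M / δ) ^ p.natDegree / ‖q.leadingCoeff‖ ∧
      ‖p.leadingCoeff - q.leadingCoeff‖ / (‖q.leadingCoeff‖ * (1 + 2 * M / δ) ^ p.natDegree) ≤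
        ‖p.eval t / q.eval t - 1‖ := by
  have hqt : q.eval t ≠ 0 := eval_ne_zero_of_far hq hδ htq
  have hpt : p.eval t ≠ 0 := eval_ne_zero_of_far hp hδ htp
  have h0 : p.natDegree = q.natDegree + 0 := hdeg
  have h0' : q.natDegree = p.natDegree + 0 := hdeg.symm
  have e1 := div_le_norm_eval_div hps hqs hq h0 hδ hM hpM hqM htp hqt
  rw [pow_zero, mul_one, ← hdeg] at e1
  refine ⟨e1, ?_, ?_⟩
  · -- upper bound = lower bound for `q/p`, inverted
    have h := div_le_norm_eval_div hqs hps hp h0' hδ hM hqM hpM htq hpt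
    rw [pow_zero, mul_one, hdeg] at h
    have hlp : 0 < ‖p.leadingCoeff‖ := norm_pos_iff.mpr (leadingCoeff_ne_zero.mpr hp)
    have hlq : 0 < ‖q.leadingCoeff‖ := norm_pos_iff.mpr (leadingCoeff_ne_zero.mpr hq)
    have hc : 0 < (1 + 2 * M / δ) ^ q.natDegree := by positivity
    rw [norm_div, div_le_div_iff₀ (by positivity) (norm_pos_iff.mpr hpt)] at h
    rw [norm_div, div_le_div_iff₀ (norm_pos_iff.mpr hqt) hlq, hdeg]
    calc ‖p.eval t‖ * ‖q.leadingCoeff‖ = ‖q.leadingCoeff‖ * ‖p.eval t‖ := mul_comm _ _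
      _ ≤ ‖q.eval t‖ * (‖p.leadingCoeff‖ * (1 + 2 * M / δ) ^ q.natDegree) := h
      _ = ‖p.leadingCoeff‖ * (1 + 2 * M / δ) ^ q.natDegree * ‖q.eval t‖ := mul_comm _ _
  · -- `β t - 1 = (p - q)(t) / q(t)`
    have hsub : p.eval t / q.eval t - 1 = (p - q).eval t / q.eval t := by
      rw [eval_sub, sub_div, div_self hqt]
    have hdeg' : (p - q).natDegree = q.natDegree :=
      (natDegree_sub_eq_of_leadingCoeff_ne hdeg hlead).trans hdeg
    have hd : p.degree = q.degree := by
      rw [degree_eq_natDegree hp, degree_eq_natDegree hq, hdeg]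
    have hlc : (p - q).leadingCoeff = p.leadingCoeff - q.leadingCoeff :=
      leadingCoeff_sub_of_degree_eq hd hlead
    have h0'' : (p - q).natDegree = q.natDegree + 0 := hdeg'
    have e3 := div_le_norm_eval_div hpqs hqs hq h0'' hδ hM hpqM hqM htpq hqt
    rw [pow_zero, mul_one, ← hdeg] at e3
    rwa [hsub, ← hlc]

/-- A common bound for the norms of the roots of `p`, `q`, `p − q`: the sum of their norms. -/
theorem norm_le_sum_norm_roots (p q : K[X]) {b : K} (hb : b ∈ p.roots + q.roots + (p - q).roots) :
    ‖b‖ ≤ ((p.roots + q.roots + (p - q).roots).map fun a => ‖a‖).sum :=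
  Multiset.single_le_sum (fun _ h => by
      obtain ⟨a, _, rfl⟩ := Multiset.mem_map.mp h
      exact norm_nonneg a)
    _ (Multiset.mem_map_of_mem _ hb)

/-- **Effective properness of `β = p/q` near the cusps** (split form, `∃ ρ` packaging): for
`p, q, p − q` split over `K`, `p, q ≠ 0`, `deg p = deg q`, `lead p ≠ lead q` and `δ > 0` there is
`ρ > 0` (depending only on `p, q, δ`) such that every `t` that is `δ`-far from all roots of `p`, `q`
and `p − q` satisfies `ρ ≤ ‖β t‖ ≤ ρ⁻¹` and `ρ ≤ ‖β t − 1‖`.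
[cite: MochizukiGenEll2010, Thm 2.1 (proof) p.12] -/
theorem exists_bounds_of_far_from_fibres {p q : K[X]} (hp : p ≠ 0) (hq : q ≠ 0)
    (hdeg : p.natDegree = q.natDegree) (hlead : p.leadingCoeff ≠ q.leadingCoeff)
    (hps : p.Splits) (hqs : q.Splits) (hpqs : (p - q).Splits) {δ : ℝ} (hδ : 0 < δ) :
    ∃ ρ : ℝ, 0 < ρ ∧ ∀ t : K, (∀ b ∈ p.roots + q.roots + (p - q).roots, δ ≤ ‖t - b‖) →
      ρ ≤ ‖p.eval t / q.eval t‖ ∧ ‖p.eval t / q.eval t‖ ≤ ρ⁻¹ ∧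
        ρ ≤ ‖p.eval t / q.eval t - 1‖ := by
  set M : ℝ := ((p.roots + q.roots + (p - q).roots).map fun a => ‖a‖).sum with hM_def
  have hM : 0 ≤ M := Multiset.sum_nonneg fun _ h => by
    obtain ⟨a, _, rfl⟩ := Multiset.mem_map.mp h
    exact norm_nonneg a
  have hlp : 0 < ‖p.leadingCoeff‖ := norm_pos_iff.mpr (leadingCoeff_ne_zero.mpr hp)
  have hlq : 0 < ‖q.leadingCoeff‖ := norm_pos_iff.mpr (leadingCoeff_ne_zero.mpr hq)
  have hlpq : 0 < ‖p.leadingCoeff - q.leadingCoeff‖ := norm_pos_iff.mpr (sub_ne_zero.mpr hlead)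
  set c : ℝ := (1 + 2 * M / δ) ^ p.natDegree with hc_def
  refine ⟨min (min (‖p.leadingCoeff‖ / (‖q.leadingCoeff‖ * c))
      (‖p.leadingCoeff - q.leadingCoeff‖ / (‖q.leadingCoeff‖ * c)))
      (‖p.leadingCoeff‖ * c / ‖q.leadingCoeff‖)⁻¹, by positivity, fun t ht => ?_⟩
  have hmem : ∀ b, b ∈ p.roots ∨ b ∈ q.roots ∨ b ∈ (p - q).roots →
      b ∈ p.roots + q.roots + (p - q).roots := fun b h => by simpa only [Multiset.mem_add, or_assoc]
  obtain ⟨h1, h2, h3⟩ := bounds_of_far_from_fibres hp hq hdeg hlead hps hqs hpqs hδ hM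
    (fun a ha => norm_le_sum_norm_roots p q (hmem a (Or.inl ha)))
    (fun b hb => norm_le_sum_norm_roots p q (hmem b (Or.inr (Or.inl hb))))
    (fun b hb => norm_le_sum_norm_roots p q (hmem b (Or.inr (Or.inr hb))))
    (fun a ha => ht a (hmem a (Or.inl ha))) (fun b hb => ht b (hmem b (Or.inr (Or.inl hb))))
    (fun b hb => ht b (hmem b (Or.inr (Or.inr hb))))
  refine ⟨(min_le_left _ _).trans ((min_le_left _ _).trans h1), h2.trans ?_,
    (min_le_left _ _).trans ((min_le_right _ _).trans h3)⟩
  calc ‖p.leadingCoeff‖ * c / ‖q.leadingCoeff‖ = (‖p.leadingCoeff‖ * c / ‖q.leadingCoeff‖)⁻¹⁻¹ :=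
        (inv_inv _).symm
    _ ≤ _ := inv_anti₀ (by positivity) (min_le_right _ _)

/-! ### Over an algebraically closed normed field: polynomials with rational coefficients -/

/-- **Effective properness of `β = p/q` near the cusps, for `p, q ∈ ℚ[X]` evaluated in an
algebraically closed normed field `K` of characteristic zero** (e.g. `K = ℂ` or `K = Q̄_ℓ`):
if `p, q ≠ 0`, `deg p = deg q`, `lead p ≠ lead q` and `δ > 0`, there is `ρ > 0` such that every
`t ∈ K` that is `δ`-far from every root in `K` of `p·q·(p − q)` has `ρ ≤ ‖β t‖ ≤ ρ⁻¹` and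
`ρ ≤ ‖β t − 1‖`, where `β t = aeval t p / aeval t q`. [cite: MochizukiGenEll2010, Thm 2.1 (proof) p.12] -/
theorem exists_bounds_of_far_from_aroots (K : Type*) [NormedField K] [CharZero K] [IsAlgClosed K]
    {p q : ℚ[X]} (hp : p ≠ 0) (hq : q ≠ 0) (hdeg : p.natDegree = q.natDegree)
    (hlead : p.leadingCoeff ≠ q.leadingCoeff) {δ : ℝ} (hδ : 0 < δ) :
    ∃ ρ : ℝ, 0 < ρ ∧ ∀ t : K, (∀ b ∈ (p * q * (p - q)).aroots K, δ ≤ ‖t - b‖) →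
      ρ ≤ ‖aeval t p / aeval t q‖ ∧ ‖aeval t p / aeval t q‖ ≤ ρ⁻¹ ∧
        ρ ≤ ‖aeval t p / aeval t q - 1‖ := by
  set φ := algebraMap ℚ K with hφ
  have hinj : Function.Injective φ := φ.injective
  set P := p.map φ with hP
  set Q := q.map φ with hQ
  have hP0 : P ≠ 0 := (Polynomial.map_ne_zero_iff hinj).mpr hp
  have hQ0 : Q ≠ 0 := (Polynomial.map_ne_zero_iff hinj).mpr hq
  have hPQdeg : P.natDegree = Q.natDegree := by
    rw [hP, hQ, natDegree_map_eq_of_injective hinj, natDegree_map_eq_of_injective hinj, hdeg]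
  have hPQlead : P.leadingCoeff ≠ Q.leadingCoeff := by
    rw [hP, hQ, leadingCoeff_map_of_injective hinj, leadingCoeff_map_of_injective hinj]
    exact fun h => hlead (hinj h)
  have hsub : P - Q = (p - q).map φ := by rw [Polynomial.map_sub]
  obtain ⟨ρ, hρ, h⟩ := exists_bounds_of_far_from_fibres hP0 hQ0 hPQdeg hPQlead
    (IsAlgClosed.splits P) (IsAlgClosed.splits Q) (IsAlgClosed.splits (P - Q)) hδ
  refine ⟨ρ, hρ, fun t ht => ?_⟩
  rw [show aeval t p = P.eval t by rw [hP, eval_map, aeval_def],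
    show aeval t q = Q.eval t by rw [hQ, eval_map, aeval_def]]
  refine h t fun b hb => ht b ?_
  -- `roots P + roots Q + roots (P - Q) = aroots (p * q * (p - q))`
  have hne' : P * Q * (P - Q) ≠ 0 :=
    mul_ne_zero (mul_ne_zero hP0 hQ0) (sub_ne_zero.mpr fun h => hPQlead (by rw [h]))
  rw [aroots_def, Polynomial.map_mul, Polynomial.map_mul, ← hsub, roots_mul hne',
    roots_mul (left_ne_zero_of_mul hne')]
  exact hb

/-! ### The number-field wrapper: `FarFromCusps` for `β(x)` from "conjugates far from the fibre" -/

/-- A ring homomorphism between fields of characteristic zero commutes with evaluation of a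
polynomial with rational coefficients: `σ(p(x)) = p(σ x)`. [folklore] -/
theorem map_aeval_rat {F L : Type*} [Field F] [CharZero F] [Field L] [CharZero L] (σ : F →+* L)
    (x : F) (p : ℚ[X]) : σ (aeval x p) = aeval (σ x) p := by
  rw [aeval_def, aeval_def, hom_eval₂, Subsingleton.elim (σ.comp (algebraMap ℚ F)) (algebraMap ℚ L)]

/-- Finitely many positive reals (indexed by a `Finset`) have a positive lower bound. [folklore] -/
theorem exists_pos_le_finset (S : Finset ℕ) (f : ℕ → ℝ) (hf : ∀ ℓ ∈ S, 0 < f ℓ) :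
    ∃ ρ : ℝ, 0 < ρ ∧ ∀ ℓ ∈ S, ρ ≤ f ℓ := by
  rcases S.eq_empty_or_nonempty with h | h
  · exact ⟨1, one_pos, by simp [h]⟩
  · exact ⟨S.inf' h f, (Finset.lt_inf'_iff h).mpr hf, fun ℓ hℓ => Finset.inf'_le f hℓ⟩

end GenEllTwo.P1Properness

open Literature.NumberTheory.DiophantineGeometry GenEllTwo.P1Properness in
/-- **`β(x)` is far from the cusps when the conjugates of `x` are far from the fibre
`β⁻¹{0,1,∞}`** — the `ℙ¹` half of the "properness" step of [GenEll] Thm. 2.1, proof p. 12, in the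
vocabulary of `GenEllAnnulus`: let `β = p/q` with `p, q ∈ ℚ[X]` nonzero of the same degree and
distinct leading coefficients (`β(∞) ∉ {0, 1, ∞}`), `S` a finite set of primes and `δ > 0`.  There
is `ρ > 0`, depending only on `p, q, S, δ`, such that for every point `P = (F, x)`: if every complex
conjugate `σ(x)` is `δ`-far from every complex root of `p·q·(p − q)`, and for each prime `ℓ ∈ S`
every `Q̄_ℓ`-conjugate `σ(x)` is `δ`-far from every root of `p·q·(p − q)` in `Q̄_ℓ`, then the point
`(F, β(x))` is `ρ`-far from the cusps at `∞` and at the primes of `S` (`NFPoint.FarFromCusps S ρ`).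
[cite: MochizukiGenEll2010, Thm 2.1 (proof) p.12] -/
theorem GenEllTwo.farFromCusps_of_far_from_aroots (S : Finset ℕ) {p q : ℚ[X]} (hp : p ≠ 0)
    (hq : q ≠ 0) (hdeg : p.natDegree = q.natDegree) (hlead : p.leadingCoeff ≠ q.leadingCoeff)
    {δ : ℝ} (hδ : 0 < δ) :
    ∃ ρ : ℝ, 0 < ρ ∧ ∀ P : GenEll.NFPoint,
      (∀ σ : P.F →+* ℂ, ∀ b ∈ (p * q * (p - q)).aroots ℂ, δ ≤ ‖σ P.x - b‖) →
      (∀ ℓ ∈ S, ∀ [Fact ℓ.Prime], ∀ σ : P.F →+* PadicAlgCl ℓ,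
          ∀ b ∈ (p * q * (p - q)).aroots (PadicAlgCl ℓ), δ ≤ ‖σ P.x - b‖) →
      GenEll.NFPoint.FarFromCusps S ρ { P with x := aeval P.x p / aeval P.x q } := by
  -- the archimedean constant
  obtain ⟨ρa, hρa, ha⟩ := exists_bounds_of_far_from_aroots ℂ hp hq hdeg hlead hδ
  -- the nonarchimedean constants, one per prime
  have hℓ : ∀ ℓ : ℕ, ∀ _ : Fact ℓ.Prime, ∃ ρ : ℝ, 0 < ρ ∧ ∀ t : PadicAlgCl ℓ,
      (∀ b ∈ (p * q * (p - q)).aroots (PadicAlgCl ℓ), δ ≤ ‖t - b‖) →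
        ρ ≤ ‖aeval t p / aeval t q‖ ∧ ‖aeval t p / aeval t q‖ ≤ ρ⁻¹ ∧
          ρ ≤ ‖aeval t p / aeval t q - 1‖ :=
    fun ℓ _ => exists_bounds_of_far_from_aroots (PadicAlgCl ℓ) hp hq hdeg hlead hδ
  choose ρf hρf hf using hℓ
  -- a prime-independent packaging of the constants, and their minimum over `S`
  let g : ℕ → ℝ := fun ℓ => if h : ℓ.Prime then ρf ℓ ⟨h⟩ else 1
  have hg : ∀ ℓ (hℓ : Fact ℓ.Prime), g ℓ = ρf ℓ hℓ := fun ℓ hℓ => dif_pos hℓ.out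
  obtain ⟨ρS, hρS, hS⟩ := exists_pos_le_finset S g fun ℓ _ => by
    by_cases h : ℓ.Prime
    · rw [hg ℓ ⟨h⟩]; exact hρf ℓ _
    · simp only [g, dif_neg h, zero_lt_one]
  refine ⟨min (ρa / 2) ρS, by positivity, fun P h1 h2 => ⟨fun σ => ?_, fun ℓ hℓS _ σ => ?_⟩⟩
  · -- archimedean conjugates
    have hσ : σ (aeval P.x p / aeval P.x q) = aeval (σ P.x) p / aeval (σ P.x) q := by
      rw [map_div₀, map_aeval_rat, map_aeval_rat]
    obtain ⟨hl, hu, h1'⟩ := ha (σ P.x) (h1 σ)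
    have hmin : min (ρa / 2) ρS < ρa := (min_le_left _ _).trans_lt (by linarith)
    change min (ρa / 2) ρS < ‖σ (aeval P.x p / aeval P.x q)‖ ∧
      ‖σ (aeval P.x p / aeval P.x q)‖ < (min (ρa / 2) ρS)⁻¹ ∧
      min (ρa / 2) ρS < ‖σ (aeval P.x p / aeval P.x q) - 1‖
    rw [hσ]
    refine ⟨hmin.trans_le hl, hu.trans_lt ?_, hmin.trans_le h1'⟩
    exact inv_strictAnti₀ (by positivity) hmin
  · -- `ℓ`-adic conjugates, `ℓ ∈ S`
    have hσ : σ (aeval P.x p / aeval P.x q) = aeval (σ P.x) p / aeval (σ P.x) q := by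
      rw [map_div₀, map_aeval_rat, map_aeval_rat]
    obtain ⟨hl, hu, h1'⟩ := hf ℓ inferInstance (σ P.x) (h2 ℓ hℓS σ)
    have hmin : min (ρa / 2) ρS ≤ ρf ℓ inferInstance :=
      (min_le_right _ _).trans ((hS ℓ hℓS).trans_eq (hg ℓ _))
    change min (ρa / 2) ρS ≤ ‖σ (aeval P.x p / aeval P.x q)‖ ∧
      ‖σ (aeval P.x p / aeval P.x q)‖ ≤ (min (ρa / 2) ρS)⁻¹ ∧
      min (ρa / 2) ρS ≤ ‖σ (aeval P.x p / aeval P.x q) - 1‖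
    rw [hσ]
    exact ⟨hmin.trans hl, hu.trans (inv_anti₀ (by positivity) hmin), hmin.trans h1'⟩

end Summit.ABC.ABC.Theorems

end
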